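import Summits.Ventures.Crystal3D.Theorems.StickyWulffConstantPolycrystalWulffBoundRungTwinFreeThreeClasses

/-!
# `PolycrystalWulffBound`, line `PolyDensity`: the induction on the number of lattice classes

Route `StickyWulffConstant` of the venture `Summits/Ventures/Crystal3D`, crux `PolycrystalWulffBound`
(item `stmt-Ventures-19482`), second prover lane (poly-p2, gen 4).  The twin-free polyhedral case of the crux for
an ARBITRARY number of lattice classes, reduced to ONE step statement: `rung_twinFree_allClasses_of_step` takes
(i) the pair-overlap constant `∀ R, 27.8 ≤ |W(1) ∩ W(R)|` (CH-P1′) and (ii) the AGGREGATED STEP — for a twin-free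
polyhedral texture with at least four classes and no dominant class, the bound follows from the bound for every
twin-free polyhedral texture on the same grains' index set with fewer classes — and proves the polycrystal Wulff
bound for every twin-free polyhedral texture, by strong induction on `#(image of f ↦ A f '' Λ)`: a dominant class
→ `rung_dominantTwinFree`; at most three classes → `rung_twinFree_threeClasses_of_overlap`; otherwise the step.
The step is what the aggregated LP (`def AggCert27_8`, rows `rec_row_of_IH` / `del_row_of_IH`, memo §12–13)
is to supply.
WHAT THIS IS NOT: the step itself; F-C1 not moved.
-/

noncomputable section

open scoped BigOperators InnerProductSpace ENNReal
open MeasureTheory Filter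

namespace Summit.Ventures.Crystal3D.Cruxes.PolycrystalWulffBound.PolyDensity

open Summit.Ventures.Crystal3D.Theorems

/-- **All classes, given the aggregated step.**  See the module docstring. -/
theorem rung_twinFree_allClasses_of_step :
    let Λ : Set (EuclideanSpace ℝ (Fin 3)) := Literature.MathematicalPhysics.StatisticalMechanics.fccStacking 1 (Real.sqrt (2 / 3));
    let Brl : (ℤ → ℤ) → Set (EuclideanSpace ℝ (Fin 3)) := Literature.MathematicalPhysics.StatisticalMechanics.barlowStacking 1 (Real.sqrt (2 / 3));
    let Ax : EuclideanSpace ℝ (Fin 3) → (EuclideanSpace ℝ (Fin 3) ≃ₗᵢ[ℝ] EuclideanSpace ℝ (Fin 3)) → (EuclideanSpace ℝ (Fin 3) ≃ₗᵢ[ℝ] EuclideanSpace ℝ (Fin 3)) → Prop := fun m A B => ∃ (L : EuclideanSpace ℝ (Fin 3) ≃ₗᵢ[ℝ] EuclideanSpace ℝ (Fin 3)) (s₁ s₂ : EuclideanSpace ℝ (Fin 3)) (σ σ' : ℤ → ℤ), Literature.MathematicalPhysics.StatisticalMechanics.IsHaggSeq σ ∧ Literature.MathematicalPhysics.StatisticalMechanics.IsHaggSeq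 σ' ∧ L (EuclideanSpace.single (2 : Fin 3) (1 : ℝ)) = m ∧ A '' Λ ⊆ (fun q => L q + s₁) '' Brl σ ∧ B '' Λ ⊆ (fun q => L q + s₂) '' Brl σ';
    let CoAx : (EuclideanSpace ℝ (Fin 3) ≃ₗᵢ[ℝ] EuclideanSpace ℝ (Fin 3)) → (EuclideanSpace ℝ (Fin 3) ≃ₗᵢ[ℝ] EuclideanSpace ℝ (Fin 3)) → Prop := fun A B => ∃ m, Ax m A B;
    let Φ : EuclideanSpace ℝ (Fin 3) → ℝ := fun ν => Real.sqrt 2 / 4 * ∑ᶠ w ∈ {w ∈ Λ | ‖w‖ = 1}, |⟪w, ν⟫_ℝ|;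
    let Per : Set (EuclideanSpace ℝ (Fin 3)) → Set (EuclideanSpace ℝ (Fin 3)) → ℝ := fun K S => (⨆ (ξ : EuclideanSpace ℝ (Fin 3) → EuclideanSpace ℝ (Fin 3)) (_ : ContDiff ℝ 1 ξ ∧ HasCompactSupport ξ ∧ ∀ z, ξ z ∈ K), ENNReal.ofReal (∫ z in S, Literature.MathematicalPhysics.StatisticalMechanics.fieldDivergence ξ z)).toReal;
    let ι : Set (EuclideanSpace ℝ (Fin 3)) → Set (EuclideanSpace ℝ (Fin 3)) → Set (EuclideanSpace ℝ (Fin 3)) → ℝ := fun K S₁ S₂ => (Per K S₁ + Per K S₂ - Per K (S₁ ∪ S₂)) / 2;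
    let W : (EuclideanSpace ℝ (Fin 3) ≃ₗᵢ[ℝ] EuclideanSpace ℝ (Fin 3)) → Set (EuclideanSpace ℝ (Fin 3)) := fun A => {y | ∀ ν : EuclideanSpace ℝ (Fin 3), ⟪y, ν⟫_ℝ ≤ Φ (A.symm ν)};
    let Dsc : EuclideanSpace ℝ (Fin 3) → Set (EuclideanSpace ℝ (Fin 3)) := fun m => {y | ‖y‖ ≤ 1 ∧ ⟪y, m⟫_ℝ = 0};
    let Tex : (n : ℕ) → (Fin n → Set (EuclideanSpace ℝ (Fin 3))) → (Fin n → (EuclideanSpace ℝ (Fin 3) ≃ₗᵢ[ℝ] EuclideanSpace ℝ (Fin 3))) → (Fin n → Fin n → ℝ) → (Fin n → Fin n → EuclideanSpace ℝ (Fin 3)) → Prop := fun n G A c m => (∀ f : Fin n, Literature.MathematicalPhysics.StatisticalMechanics.HasFinitePerimeter (G f) ∧ volume (G f) < ⊤) ∧ (∀ f g, f ≠ g → Disjoint (G f) (G g)) ∧ (∀ f g, f ≠ g → 0 ≤ c f g) ∧ (∀ f g, f ≠ g → ¬ CoAx (A f) (A g) → m f g = 0 ∧ 1 ≤ c f g)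 ∧ (∀ f g, f ≠ g → CoAx (A f) (A g) → A f '' Λ ≠ A g '' Λ → Ax (m f g) (A f) (A g) ∧ 1 / 2 ≤ c f g);
    let En : (n : ℕ) → (Fin n → Set (EuclideanSpace ℝ (Fin 3))) → (Fin n → (EuclideanSpace ℝ (Fin 3) ≃ₗᵢ[ℝ] EuclideanSpace ℝ (Fin 3))) → (Fin n → Fin n → ℝ) → (Fin n → Fin n → EuclideanSpace ℝ (Fin 3)) → ℝ := fun n G A c m => ∑ f : Fin n, Per (W (A f)) (G f) - ∑ f, ∑ g, (if f = g then 0 else ι (W (A f)) (G f) (G g)) + ∑ f, ∑ g, (if f = g then 0 else c f g / 2 * ι (Dsc (m f g)) (G f) (G g));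
    let Vol : (n : ℕ) → (Fin n → Set (EuclideanSpace ℝ (Fin 3))) → ℝ := fun n G => (volume (⋃ f : Fin n, G f)).toReal;
    let Poly : Set (EuclideanSpace ℝ (Fin 3)) → Prop := fun S => ∃ (k : ℕ) (H : Fin k → Finset ((EuclideanSpace ℝ (Fin 3)) × ℝ)), S = ⋃ i, ⋂ p ∈ H i, {x | ⟪p.1, x⟫_ℝ < p.2};
    let TF : (n : ℕ) → (Fin n → (EuclideanSpace ℝ (Fin 3) ≃ₗᵢ[ℝ] EuclideanSpace ℝ (Fin 3))) → Prop := fun n A => ∀ f g : Fin n, f ≠ g → CoAx (A f) (A g) → A f '' Λ = A g '' Λ;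
    (∀ R : EuclideanSpace ℝ (Fin 3) ≃ₗᵢ[ℝ] EuclideanSpace ℝ (Fin 3), (27.8 : ℝ) ≤ (volume (W (LinearIsometryEquiv.refl ℝ (EuclideanSpace ℝ (Fin 3))) ∩ W R)).toReal) →
      (∀ (n : ℕ) (G : Fin n → Set (EuclideanSpace ℝ (Fin 3))) (A : Fin n → (EuclideanSpace ℝ (Fin 3) ≃ₗᵢ[ℝ] EuclideanSpace ℝ (Fin 3))) (c : Fin n → Fin n → ℝ) (m : Fin n → Fin n → EuclideanSpace ℝ (Fin 3)),
        Tex n G A c m → (∀ f, Poly (G f)) → TF n A →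
        (∀ f₀ : Fin n, (volume (⋃ g ∈ {g : Fin n | A g '' Λ = A f₀ '' Λ}, G g)).toReal < 17 / 20 * Vol n G) →
        4 ≤ (Finset.univ.image fun f => A f '' Λ).card →
        (∀ (G' : Fin n → Set (EuclideanSpace ℝ (Fin 3))) (A' : Fin n → (EuclideanSpace ℝ (Fin 3) ≃ₗᵢ[ℝ] EuclideanSpace ℝ (Fin 3))) (c' : Fin n → Fin n → ℝ) (m' : Fin n → Fin n → EuclideanSpace ℝ (Fin 3)),
          Tex n G' A' c' m' → (∀ f, Poly (G' f)) → TF n A' →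
          (Finset.univ.image fun f => A' f '' Λ).card < (Finset.univ.image fun f => A f '' Λ).card →
          6 * (2 : ℝ) ^ ((1 : ℝ) / 3) * (Real.sqrt 2 * Vol n G') ^ ((2 : ℝ) / 3) ≤ En n G' A' c' m') →
        6 * (2 : ℝ) ^ ((1 : ℝ) / 3) * (Real.sqrt 2 * Vol n G) ^ ((2 : ℝ) / 3) ≤ En n G A c m) →
      ∀ (n : ℕ) (G : Fin n → Set (EuclideanSpace ℝ (Fin 3))) (A : Fin n → (EuclideanSpace ℝ (Fin 3) ≃ₗᵢ[ℝ] EuclideanSpace ℝ (Fin 3))) (c : Fin n → Fin n → ℝ) (m : Fin n → Fin n → EuclideanSpace ℝ (Fin 3)),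
        Tex n G A c m → (∀ f, Poly (G f)) → TF n A → 6 * (2 : ℝ) ^ ((1 : ℝ) / 3) * (Real.sqrt 2 * Vol n G) ^ ((2 : ℝ) / 3) ≤ En n G A c m := by
  intro Λ Brl Ax CoAx Φ Per ι W Dsc Tex En Vol Poly TF hOv hstep
  -- strong induction on the number of classes
  suffices key : ∀ (N n : ℕ) (G : Fin n → Set (EuclideanSpace ℝ (Fin 3))) (A : Fin n → (EuclideanSpace ℝ (Fin 3) ≃ₗᵢ[ℝ] EuclideanSpace ℝ (Fin 3))) (c : Fin n → Fin n → ℝ)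
      (m : Fin n → Fin n → EuclideanSpace ℝ (Fin 3)), Tex n G A c m → (∀ f, Poly (G f)) → TF n A →
      (Finset.univ.image fun f => A f '' Λ).card = N → 6 * (2 : ℝ) ^ ((1 : ℝ) / 3) * (Real.sqrt 2 * Vol n G) ^ ((2 : ℝ) / 3) ≤ En n G A c m by
    intro n G A c m hTex hPoly hTF; exact key _ n G A c m hTex hPoly hTF rfl
  intro N
  induction N using Nat.strong_induction_on with
  | _ N IH =>
  intro n G A c m hTex hPoly hTF hN
  classical
  -- a dominant class
  by_cases hdom : ∃ f₀ : Fin n, 17 / 20 * Vol n G ≤ (volume (⋃ g ∈ {g : Fin n | A g '' Λ = A f₀ '' Λ}, G g)).toReal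
  · exact rung_dominantTwinFree n G A c m hTex hPoly hTF hdom
  push Not at hdom
  by_cases h4 : 4 ≤ (Finset.univ.image fun f => A f '' Λ).card
  · -- at least four classes: the aggregated step with the induction hypothesis
    refine hstep n G A c m hTex hPoly hTF hdom h4 ?_
    intro G' A' c' m' hTex' hPoly' hTF' hlt
    exact IH _ (hN ▸ hlt) n G' A' c' m' hTex' hPoly' hTF' rfl
  · -- at most three classes: pigeonhole on four grains
    have h3 : (Finset.univ.image fun f => A f '' Λ).card ≤ 3 := by omega
    have hThree : ∀ f g h k : Fin n, A f '' Λ = A g '' Λ ∨ A f '' Λ = A h '' Λ ∨ A f '' Λ = A k '' Λ ∨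
        A g '' Λ = A h '' Λ ∨ A g '' Λ = A k '' Λ ∨ A h '' Λ = A k '' Λ := by
      intro f g h k
      by_contra hcon
      push Not at hcon
      obtain ⟨h1, h2, h3', h4', h5, h6⟩ := hcon
      have hsub : ({A f '' Λ, A g '' Λ, A h '' Λ, A k '' Λ} : Finset (Set (EuclideanSpace ℝ (Fin 3)))) ⊆
          Finset.univ.image fun f => A f '' Λ := by
        intro x hx
        simp only [Finset.mem_insert, Finset.mem_singleton] at hx
        rcases hx with rfl | rfl | rfl | rfl <;> exact Finset.mem_image_of_mem _ (Finset.mem_univ _)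
      have hcard : ({A f '' Λ, A g '' Λ, A h '' Λ, A k '' Λ} : Finset (Set (EuclideanSpace ℝ (Fin 3)))).card = 4 := by
        rw [Finset.card_insert_of_notMem, Finset.card_insert_of_notMem, Finset.card_insert_of_notMem,
          Finset.card_singleton]
        · simpa using h6
        · simp only [Finset.mem_insert, Finset.mem_singleton, not_or]; exact ⟨h4', h5⟩
        · simp only [Finset.mem_insert, Finset.mem_singleton, not_or]; exact ⟨h1, h2, h3'⟩
      have := Finset.card_le_card hsub
      omega
    exact rung_twinFree_threeClasses_of_overlap n G A c m hTex hPoly hTF hThree hOv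

end Summit.Ventures.Crystal3D.Cruxes.PolycrystalWulffBound.PolyDensity

end
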